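import Summits.BirchSwinnertonDyer.Rank1Residual.X11b.KolyvaginHpointsAssemblyAt
import Summits.BirchSwinnertonDyer.Rank1Residual.X11b.KolyvaginReciprocityFinsetOfPoitouTate
import Summits.BirchSwinnertonDyer.Rank1Residual.X11b.KolyvaginHGZOfKodairaNeron
import Literature.NumberTheory.EllipticCurves.HeegnerPointsKolyvaginPrimaryAnnihilatorAtPrimeProofs
import HarnessLib

/-!
# Kolyvagin's annihilator `p^{ord_p y_K} · Ш(E/K)[p^∞] = 0` at ONE odd surjective prime, from the
# cite-only leaf inputs AT that prime (cell `b2b-bsdres`, team x11b3 = N8/O2; x11b3-p2 GEN 37, (P2-KOLYC))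

HONEST FRAMING (cell `b2b-bsdres`, run/shared/lean/b2b/bsd-rank1-residual/, verbatim in every
file): the goal of the cell is to DELETE the COMBINATION-SHAPED residual classes of the
Birch–Swinnerton-Dyer formula for ALL analytic-rank `≤ 1` elliptic curves over `ℚ` — "full BSD
formula for every rank `≤ 1` curve in class `C`" assembled STRICTLY from published theorems — so
that the rank-`≤ 1` remainder becomes exactly the CONSTRUCTION-SHAPED classes, which are TYPED
(missing-input `Prop`s), NOT attempted. This is not "finishing BSD". Team N8/O2 = `x11b3`.
THEOREMS ONLY (no `def`, no `sorry`, no new fact); plumbing over tree theorems; cite-only labels are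
NOT facts; nothing discharged; nothing booked; no mark / label / count / tier moves.

## What this file adds (x11b3-p2 GEN 37; lead DEAL pending)

The per-prime telescope of record (`KolyvaginShaFiniteAtPrime`, p323190) concludes "`Ш(E/K)[p^∞]`
FINITE"; the banked exponent telescope (P2-QUANT, x11b3-p2 GEN 36) concludes
"`p^{2m} · Ш(E/K)[p^∞] = 0`" (Gross 1991 §10 Claim 10.3 modulo `p^M`).  Here, from the SAME SIX
labels, **Kolyvagin's own exponent**: "`p^m · Ш(E/K)[p^∞] = 0` for every `m` with `p^{m+1} ∤ y_K`"
(V. A. Kolyvagin, Proc. ICM Kyoto 1990, §2: *"`C' S'_M = 0` … the divisor and main component of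
which is `C`"*, `C = p^{M₀}`, `M₀ = ord_p [E(K) : ℤ y_K]` by McCallum's Lemma 5.1).  The factor is
recovered by McCallum's Prop. 2.2 (the reciprocity law over ALL places) used at TWO Kolyvagin places
— `KolyvaginReciprocity.kolyvaginReciprocityFinset_of_poitouTate`, from the SAME named fact `hPT` —
and the abstract descent `KolyvaginDescent.HypothesesM.pow_M₀_zsmul_mem_zmultiples` (Literature,
`HeegnerPointsKolyvaginPrimaryAnnihilatorProofs`).  The ORDER form of McCallum §1 Theorem
(`ord_p #Ш(E/K) ≤ 2 ord_p [E(K):ℤy_K]`, the tree's named fact `Kolyvagin1990_padicValNat_card_sha_le`)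
is NOT obtained (it needs the Cassels–Tate pairing of Kolyvagin's classes, McCallum Prop. 4.7 /
Thm. 5.4).

* `pow_smul_sha_primary_eq_zero_at_of_leafInputs_of_poitouTate` — SIX labels AT `p`:
  {`hPT`, `hrec`, `hCM`, `h53`, `hGZ`, `hγ`} + `hN`;
* `pow_smul_sha_primary_eq_zero_at_of_leafInputs_of_poitouTate_of_kodairaNeron` — FIVE labels on the
  Kodaira–Néron sub-class (KN_p) (`hGZ` supplied by `KolyvaginHloc.hGZ_of_kodairaNeron`, p319336).

Namespace `Summit.BirchSwinnertonDyer.Rank1Residual.X11b.KolyvaginAnnihilator` (binders of the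
`KolyvaginAssembly` telescopes VERBATIM; `K : Type`); axioms `propext`, `Classical.choice`,
`Quot.sound`.

## References

* [McCallumLMS1991] §1 Theorem (Kolyvagin) p. 296, Lemma 5.1 p. 303, §2 Prop. 2.2, §§4–5 (held,
  PDF pp. 276–287). [GrossLMS1991] Thm. 1.3 (2), §§3–8, §10 (held, chunks 212–231).
* [Kolyvagin1990] Proc. ICM Kyoto 1990, §2 (galaxy panama:376007206895683); *Euler systems*, Thm. A
  (cite only; acq-00132). [MilneADT2006] Ch. I Thm. 4.10(b). [SilvermanAEC2009] Thm. VII.6.1.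
-/

noncomputable section

open scoped Classical
open WeierstrassCurve Field NumberField IsDedekindDomain
open Literature.NumberTheory.EllipticCurves Literature.NumberTheory.GaloisRepresentations
open Literature.NumberTheory.EllipticCurves.RingClassField
open Literature.NumberTheory.EllipticCurves.ModularForms
open Literature.NumberTheory.DiophantineGeometry Literature.NumberTheory.DiophantineGeometry.TateAlgorithm

namespace Summit.BirchSwinnertonDyer.Rank1Residual.X11b.KolyvaginAnnihilator

open KolyvaginAssembly

-- `K : Type`: the tree's ring-class class field theory is universe `0`.
variable {K : Type} [Field K] [NumberField K] {N : ℕ} {W : WeierstrassCurve ℚ}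

/-- **Kolyvagin's annihilator at ONE odd prime `p` with `ρ̄_{E,p}` onto: `p^m · Ш(E/K)[p^∞] = 0`
for every `m` with `p^{m+1} ∤ y_K` in `E(K)`, from the cite-only printed inputs AT `p` with
Kolyvagin reciprocity SUPPLIED modulo the Poitou–Tate named fact** — the composition of
`KolyvaginDescent.pow_smul_sha_primary_eq_zero_at_of_pointsM_of_reciprocityFinset` (Literature,
this lineage: McCallum 1991 §1 Theorem in EXPONENT form with KOLYVAGIN's exponent `m`, paid for by
the reciprocity law Prop. 2.2 at two Kolyvagin places) with `KolyvaginAssembly.hpoints_at_of_perLevelChoice`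
(p321380) and `KolyvaginReciprocity.kolyvaginReciprocityFinset_of_poitouTate` (this lineage: (R)_M
against Selmer classes vanishing on a finite set of places, from `hPT`).  Binders = those of
`KolyvaginAssembly.sha_primary_finite_at_of_leafInputs_of_poitouTate` (p323190) VERBATIM; conclusion
quantitative.  For ONE odd prime `p` with `ρ̄_{E,p}` onto, `E` non-CM, `K` imaginary quadratic with
`d_K ∉ {−3, −4}` and the Heegner hypothesis, `P` a non-torsion Heegner point and `p^{m+1} ∤ P` in
`E(K)`: every class of `Ш(E/K)[p^∞]` is killed by `p^m` ⟸ EXACTLY {`hPT` (existing named fact),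
`hrec`, `hCM`, `h53`, `hGZ`, `hγ`} AT `p` + `hN` — SIX labelled inputs; cite-only, NOT discharged;
the ORDER form (`Kolyvagin1990_padicValNat_card_sha_le`) NOT obtained; nothing booked; no mark.
[cite: McCallumLMS1991, §1 Theorem (Kolyvagin), Lemma 5.1, §2 Prop. 2.2, §§4–5]
[cite: GrossLMS1991, Thm. 1.3 (2), §§3–8, §10] [cite: MilneADT2006, Ch. I Thm. 4.10(b)] -/
theorem pow_smul_sha_primary_eq_zero_at_of_leafInputs_of_poitouTate [NeZero N] [W.IsGloballyMinimal]
    {p : ℕ} (hp : p.Prime) (hp2 : p ≠ 2)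
    (hPT : Literature.NumberTheory.GaloisCohomology.poitouTate_sum_localTatePairing_eq_zero K)
    (hN : ∀ [W.IsElliptic], N = W.conductorNorm ℤ)
    (hrec : heegnerPointOfConductor_one_galoisConj N W K)
    (hCM : ∀ [W.IsElliptic] (_hK : IsImaginaryQuadratic K) (_hH : SatisfiesHeegnerHypothesis N K)
      (Dt : ModularParametrizationData W N) (β : ℤ) (ι : K →+* ℂ),
      (4 * N : ℤ) ∣ β ^ 2 - NumberField.discr K →
      ∀ {M : ℕ}, 1 ≤ M → ∀ (m : ℕ), Squarefree m →
      (∀ q ∈ m.primeFactors, IsKolyvaginPrime N W K p q ∧ FrobEqFrobInfty W K (p ^ M) q) →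
      ∃ y : (W.baseChange (ringClassField K ι m)).toAffine.Point,
        WeierstrassCurve.Affine.Point.map (W' := W) (ringClassField K ι m).subtype.toRatAlgHom y =
          heegnerPointComplexOfConductor Dt (NumberField.discr K) β m)
    (h53 : ∀ [W.IsElliptic] (_hK : IsImaginaryQuadratic K) (_hH : SatisfiesHeegnerHypothesis N K)
      (Dt : ModularParametrizationData W N) (β : ℤ) (ι : K →+* ℂ) {M : ℕ}
      (_hM : 1 ≤ M) {n : ℕ} (_hn : Squarefree n)
      (_hKol : ∀ q ∈ n.primeFactors, IsKolyvaginPrime N W K p q ∧ FrobEqFrobInfty W K (p ^ M) q)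
      (d : (m : ℕ) → m ∣ n → KolyvaginHeegnerData Dt β ι m) (m : ℕ) (hm : m ∣ n)
      (τm : ringClassField K ι m ≃ₐ[ℚ] ringClassField K ι m),
      (∀ x : ringClassField K ι m, ((τm x : ringClassField K ι m) : ℂ) = starRingEnd ℂ x) →
      ∃ σ' ∈ ringClassGal ι m, IsOfFinAddOrder
        (pointGalHom W (ringClassField K ι m) τm (d m hm).y -
          (-W.rootNumber) • pointGalHom W (ringClassField K ι m) σ' (d m hm).y))
    (hGZ : ∀ [W.IsElliptic] (_hK : IsImaginaryQuadratic K) (_hH : SatisfiesHeegnerHypothesis N K)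
      (Dt : ModularParametrizationData W N) (β : ℤ) (ι : K →+* ℂ) {M : ℕ} (_hM : 1 ≤ M) {n : ℕ}
      (_hn : Squarefree n)
      (_hKol : ∀ q ∈ n.primeFactors, IsKolyvaginPrime N W K p q ∧ FrobEqFrobInfty W K (p ^ M) q)
      (d : (m : ℕ) → m ∣ n → KolyvaginHeegnerData Dt β ι m),
      ∃ n' : ℤ, IsCoprime ((p ^ M : ℕ) : ℤ) n' ∧
        ∀ (m : ℕ) (hm : m ∣ n) (γ : ringClassField K ι m ≃ₐ[ℚ] ringClassField K ι m),
          γ ∈ ringClassGal ι m → ∀ v : HeightOneSpectrum (𝓞 K),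
            ¬ (W.baseChange K).HasGoodReductionAt v →
            n' • pointsMap (W.baseChange K) (v.adicCompletion K)
                ((d m hm).toGeomPoints (pointGalHom W (ringClassField K ι m) γ (d m hm).y)) ∈
              E0Receptacle (W.baseChange K) v ∧
            ∀ (ℓ : ℕ) (hℓ : ℓ ∈ m.primeFactors)
              (hle : ringClassField K ι (m / ℓ) ≤ ringClassField K ι m),
              n' • pointsMap (W.baseChange K) (v.adicCompletion K)
                  ((d m hm).toGeomPoints (pointGalHom W (ringClassField K ι m) γ
                    (WeierstrassCurve.Affine.Point.map (W' := W)
                      ((RingClassField.inclusion ι hle).restrictScalars ℚ)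
                      (d (m / ℓ)
                        ((Nat.div_dvd_of_dvd (Nat.dvd_of_mem_primeFactors hℓ)).trans hm)).y))) ∈
                E0Receptacle (W.baseChange K) v)
    (hγ : ∀ [W.IsElliptic] (_hK : IsImaginaryQuadratic K) (_hH : SatisfiesHeegnerHypothesis N K)
      (Dt : ModularParametrizationData W N) (β : ℤ) (ι : K →+* ℂ) {M : ℕ}
      (_hM : 1 ≤ M) {n : ℕ} (_hn : Squarefree n)
      (_hKol : ∀ q ∈ n.primeFactors, IsKolyvaginPrime N W K p q ∧ FrobEqFrobInfty W K (p ^ M) q)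
      (d : (m : ℕ) → m ∣ n → KolyvaginHeegnerData Dt β ι m)
      (m : ℕ) (hm : m ∣ n) (ℓ : ℕ) (hℓ : ℓ ∈ m.primeFactors) [Fact ℓ.Prime]
      (hΔ : ¬ (ℓ : ℤ) ∣ minimalDiscriminantInt W) (φ₀ : absoluteGaloisGroup (ZMod ℓ)),
      (∀ x : AlgebraicClosure (ZMod ℓ), φ₀ • x = x ^ ℓ) →
      ∀ (hle : ringClassField K ι (m / ℓ) ≤ ringClassField K ι m)
        (γ : ringClassField K ι m ≃ₐ[ℚ] ringClassField K ι m), γ ∈ ringClassGal ι m →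
        geomReduction hΔ ((RatClosure.pointsEquiv (K := K) W).symm
            ((d m hm).toGeomPoints (pointGalHom W (ringClassField K ι m) γ (d m hm).y))) =
          φ₀ • geomReduction hΔ ((RatClosure.pointsEquiv (K := K) W).symm
            ((d m hm).toGeomPoints (pointGalHom W (ringClassField K ι m) γ
              (WeierstrassCurve.Affine.Point.map (W' := W)
                ((RingClassField.inclusion ι hle).restrictScalars ℚ)
                (d (m / ℓ)
                  ((Nat.div_dvd_of_dvd (Nat.dvd_of_mem_primeFactors hℓ)).trans hm)).y))))) :
    ∀ [W.IsElliptic] (_hE : ¬ W.HasCM) (_hK : IsImaginaryQuadratic K)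
      (_hD : NumberField.discr K ≠ -3 ∧ NumberField.discr K ≠ -4)
      (_hH : SatisfiesHeegnerHypothesis N K)
      {P : (W.baseChange K).toAffine.Point} (_hP : IsHeegnerPoint N W K P)
      (_hnt : ¬ IsOfFinAddOrder P) (_hρ : W.HasSurjectiveModNGaloisRep p) {m : ℕ}
      (_hm : ∀ Q : (W.baseChange K).toAffine.Point, p ^ (m + 1) • Q ≠ P) (c : (W.baseChange K).sha),
      (∃ j : ℕ, p ^ j • c = 0) → p ^ m • c = 0 := by
  intro _ hE hK hD hH P hP hnt hρ m hm
  exact KolyvaginDescent.pow_smul_sha_primary_eq_zero_at_of_pointsM_of_reciprocityFinset W hK hP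
    hnt hp hp2 hρ hm (hpoints_at_of_perLevelChoice hN hK hD hH hP hp hp2 hρ hrec hCM h53 hGZ hγ)
    (@fun _ hM _ hℓ hℓM ↦ KolyvaginReciprocity.kolyvaginReciprocityFinset_of_poitouTate N W K hPT hE
      hK hD hH hP hnt hp hp2 hρ hM hℓ hℓM)


/-- **Kolyvagin's annihilator at ONE odd surjective prime `p` from FIVE cite-only inputs on the
Kodaira–Néron sub-class AT `p`**: `pow_smul_sha_primary_eq_zero_at_of_leafInputs_of_poitouTate` with
its binder `hGZ` ([GZ86 III (3.1)] at `p`) SUPPLIED by `KolyvaginHloc.hGZ_of_kodairaNeron` (p319336)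
under `hKNm` (`p ∤ ord_v(Δ_min(E/K))` at every multiplicative `v`) and `hKNa` (`p ≠ 3`, or no
additive place of type IV / IV*).  Binders = those of
`sha_primary_finite_at_of_leafInputs_of_poitouTate_of_kodairaNeron` (p323190) VERBATIM.  CONDITIONAL on
EXACTLY {`hPT` (named fact), `hrec`, `hCM`, `h53`, `hγ`} AT `p` + `hN` + (KN_p); cite-only, NOT
discharged except `hGZ`; nothing booked; no mark. [cite: GrossLMS1991, Thm. 1.3 (2), Prop. 6.2 (1)]
[cite: SilvermanAEC2009, Thm. VII.6.1] [cite: McCallumLMS1991, §1 Theorem (Kolyvagin), §2 Prop. 2.2] -/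
theorem pow_smul_sha_primary_eq_zero_at_of_leafInputs_of_poitouTate_of_kodairaNeron [NeZero N]
    [W.IsGloballyMinimal] {p : ℕ} (hp : p.Prime) (hp2 : p ≠ 2)
    (hPT : Literature.NumberTheory.GaloisCohomology.poitouTate_sum_localTatePairing_eq_zero K)
    (hN : ∀ [W.IsElliptic], N = W.conductorNorm ℤ)
    (hrec : heegnerPointOfConductor_one_galoisConj N W K)
    (hCM : ∀ [W.IsElliptic] (_hK : IsImaginaryQuadratic K) (_hH : SatisfiesHeegnerHypothesis N K)
      (Dt : ModularParametrizationData W N) (β : ℤ) (ι : K →+* ℂ),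
      (4 * N : ℤ) ∣ β ^ 2 - NumberField.discr K →
      ∀ {M : ℕ}, 1 ≤ M → ∀ (m : ℕ), Squarefree m →
      (∀ q ∈ m.primeFactors, IsKolyvaginPrime N W K p q ∧ FrobEqFrobInfty W K (p ^ M) q) →
      ∃ y : (W.baseChange (ringClassField K ι m)).toAffine.Point,
        WeierstrassCurve.Affine.Point.map (W' := W) (ringClassField K ι m).subtype.toRatAlgHom y =
          heegnerPointComplexOfConductor Dt (NumberField.discr K) β m)
    (h53 : ∀ [W.IsElliptic] (_hK : IsImaginaryQuadratic K) (_hH : SatisfiesHeegnerHypothesis N K)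
      (Dt : ModularParametrizationData W N) (β : ℤ) (ι : K →+* ℂ) {M : ℕ}
      (_hM : 1 ≤ M) {n : ℕ} (_hn : Squarefree n)
      (_hKol : ∀ q ∈ n.primeFactors, IsKolyvaginPrime N W K p q ∧ FrobEqFrobInfty W K (p ^ M) q)
      (d : (m : ℕ) → m ∣ n → KolyvaginHeegnerData Dt β ι m) (m : ℕ) (hm : m ∣ n)
      (τm : ringClassField K ι m ≃ₐ[ℚ] ringClassField K ι m),
      (∀ x : ringClassField K ι m, ((τm x : ringClassField K ι m) : ℂ) = starRingEnd ℂ x) →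
      ∃ σ' ∈ ringClassGal ι m, IsOfFinAddOrder
        (pointGalHom W (ringClassField K ι m) τm (d m hm).y -
          (-W.rootNumber) • pointGalHom W (ringClassField K ι m) σ' (d m hm).y))
    (hKNm : ∀ [W.IsElliptic] (v : HeightOneSpectrum (𝓞 K)),
      (W.baseChange K).HasMultiplicativeReductionAt v →
        ¬ p ∣ (W.baseChange K).ordMinimalDiscriminant v)
    (hKNa : ∀ [W.IsElliptic] (v : HeightOneSpectrum (𝓞 K)),
      (W.baseChange K).HasAdditiveReductionAt v → p ≠ 3 ∨
        ((W.baseChange K).kodairaSymbolAt v ≠ KodairaSymbol.IV ∧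
          (W.baseChange K).kodairaSymbolAt v ≠ KodairaSymbol.IVstar))
    (hγ : ∀ [W.IsElliptic] (_hK : IsImaginaryQuadratic K) (_hH : SatisfiesHeegnerHypothesis N K)
      (Dt : ModularParametrizationData W N) (β : ℤ) (ι : K →+* ℂ) {M : ℕ}
      (_hM : 1 ≤ M) {n : ℕ} (_hn : Squarefree n)
      (_hKol : ∀ q ∈ n.primeFactors, IsKolyvaginPrime N W K p q ∧ FrobEqFrobInfty W K (p ^ M) q)
      (d : (m : ℕ) → m ∣ n → KolyvaginHeegnerData Dt β ι m)
      (m : ℕ) (hm : m ∣ n) (ℓ : ℕ) (hℓ : ℓ ∈ m.primeFactors) [Fact ℓ.Prime]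
      (hΔ : ¬ (ℓ : ℤ) ∣ minimalDiscriminantInt W) (φ₀ : absoluteGaloisGroup (ZMod ℓ)),
      (∀ x : AlgebraicClosure (ZMod ℓ), φ₀ • x = x ^ ℓ) →
      ∀ (hle : ringClassField K ι (m / ℓ) ≤ ringClassField K ι m)
        (γ : ringClassField K ι m ≃ₐ[ℚ] ringClassField K ι m), γ ∈ ringClassGal ι m →
        geomReduction hΔ ((RatClosure.pointsEquiv (K := K) W).symm
            ((d m hm).toGeomPoints (pointGalHom W (ringClassField K ι m) γ (d m hm).y))) =
          φ₀ • geomReduction hΔ ((RatClosure.pointsEquiv (K := K) W).symm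
            ((d m hm).toGeomPoints (pointGalHom W (ringClassField K ι m) γ
              (WeierstrassCurve.Affine.Point.map (W' := W)
                ((RingClassField.inclusion ι hle).restrictScalars ℚ)
                (d (m / ℓ)
                  ((Nat.div_dvd_of_dvd (Nat.dvd_of_mem_primeFactors hℓ)).trans hm)).y))))) :
    ∀ [W.IsElliptic] (_hE : ¬ W.HasCM) (_hK : IsImaginaryQuadratic K)
      (_hD : NumberField.discr K ≠ -3 ∧ NumberField.discr K ≠ -4)
      (_hH : SatisfiesHeegnerHypothesis N K)
      {P : (W.baseChange K).toAffine.Point} (_hP : IsHeegnerPoint N W K P)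
      (_hnt : ¬ IsOfFinAddOrder P) (_hρ : W.HasSurjectiveModNGaloisRep p) {m : ℕ}
      (_hm : ∀ Q : (W.baseChange K).toAffine.Point, p ^ (m + 1) • Q ≠ P) (c : (W.baseChange K).sha),
      (∃ j : ℕ, p ^ j • c = 0) → p ^ m • c = 0 :=
  pow_smul_sha_primary_eq_zero_at_of_leafInputs_of_poitouTate hp hp2 hPT hN hrec hCM h53
    (@fun _ hK _ Dt _ ι _ _ _ hn hKol d ↦
      KolyvaginHloc.hGZ_of_kodairaNeron hK ι Dt hp hp2 hn hKol d hKNm hKNa) hγ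


end Summit.BirchSwinnertonDyer.Rank1Residual.X11b.KolyvaginAnnihilator

end
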